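import Mathlib.Analysis.Calculus.ParametricIntegral
import Literature.Analysis.FluidPDE.StretchedLayerStripEnergy
import Literature.Analysis.FluidPDE.StretchedLayerShiftSystem
import HarnessLib

/-!
# Period rigidity of the stretched layer system in the energy class

Analysis/FluidPDE file (theorems only, everything proved). The **energy-class period rigidity**
of classical solutions of the stretched two-dimensional Navier–Stokes layer system
(`IsStretchedLayerNSSolutionOn` of `StretchedLayerNS`):

`IsStretchedLayerNSSolutionOn.periodic_of_hasLayerEnergyTails` — a classical solution
`(u, v, p)` on the time set `(0, ∞)` with `x`-period `nℓ` (`n ≥ 1`, `ℓ > 0`, `ν, γ ≥ 0`), whose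
velocity is continuous up to `t = 0` with an `ℓ`-periodic datum and has energy-class tails
(`StretchedLayer.HasLayerEnergyTails u v`), has `ℓ`-periodic velocity for all `t ≥ 0`.

This is Majda–Bertozzi's basic energy estimate and uniqueness corollary (*Vorticity and
Incompressible Flow*, CUP 2002, §3.1.1 Prop. 3.1 / Cor. 3.1, p. 88) in the form of the Remark
after Prop. 3.4 (p. 93: uniqueness relative to a known non-decaying background for perturbations
of finite energy), applied to the solution and its own `ℓ`-translate: the shift difference
`W = (u, v)(t, x + ℓ, y) − (u, v)(t, x, y)` solves the linearised system on the period strip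
`(0, nℓ] × ℝ` (`StretchedLayerShiftSystem`), its strip energy
`E(t) = ∫∫ |W|²` is continuous on `[0, T]` with `E(0) = 0` (dominated convergence, the datum being
`ℓ`-periodic; `continuousOn_shiftEnergy`), differentiable on `(0, T)` with
`E' ≤ 2(2C + γ)E` (differentiation under the integral sign and the basic energy inequality
`StretchedLayer.StripEnergyHypotheses.integral_mul_add_mul_le`; `hasDerivAt_shiftEnergy`), so
`E ≡ 0` by Grönwall (`StretchedLayer.eq_zero_of_hasDerivAt_le_mul`), and `W ≡ 0` by continuity
and periodicity.

## References

* A. J. Majda, A. L. Bertozzi, *Vorticity and Incompressible Flow*, CUP 2002, §3.1.1 eq. (3.5),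
  Lemma 3.1, Prop. 3.1, Cor. 3.1 (p. 87–88); §3.1.3 Prop. 3.4 and the Remark following it
  (p. 93). [MajdaBertozzi2002]
-/

noncomputable section

open Set Function Filter
open _root_.MeasureTheory
open scoped Topology

namespace Literature.Analysis.FluidPDE

open StretchedLayer

variable {ν γ ΔU L : ℝ} {u v p : ℝ → ℝ → ℝ → ℝ}

/-- Products of bounded factors: `|g₁| ≤ M₁`, `|g₂| ≤ M₂` give `|g₁ g₂| ≤ M₁ M₂` (private copy;
a public version is `Literature.Analysis.FluidPDE.CompressibleEuler.abs_mul_le_of_le`, not in this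
import closure). [folklore] -/
private theorem abs_mul_le_mul_of_abs_le {g₁ g₂ M₁ M₂ : ℝ} (h₁ : |g₁| ≤ M₁) (h₂ : |g₂| ≤ M₂) :
    |g₁ * g₂| ≤ M₁ * M₂ := by
  rw [abs_mul]
  exact mul_le_mul h₁ h₂ (abs_nonneg _) ((abs_nonneg _).trans h₁)

/-! ### The strip energy of the shift difference is continuous down to `t = 0` -/

/-- **Continuity of the shift energy on `[0, T]`.** For a solution on `(0, ∞)` whose velocity is
continuous on `[0, ∞) × ℝ²` with `ℓ`-periodic datum and whose `x`-derivatives decay like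
`Ce^{−k|y|}` on `(0, T]`, the strip energy of the shift difference
`t ↦ ∫∫_{(0,L]×ℝ} (|u(t,x+ℓ,y) − u(t,x,y)|² + |v(t,x+ℓ,y) − v(t,x,y)|²)` is continuous on `[0, T]`
(dominated convergence: the shift differences are bounded by `|C|ℓe^{−k|y|}` for `t ∈ (0, T]`
and vanish at `t = 0`). [folklore] -/
theorem IsStretchedLayerNSSolutionOn.continuousOn_shiftEnergy
    (h : IsStretchedLayerNSSolutionOn (Ioi 0) ν γ ΔU L u v p)
    (hu0 : ContinuousOn (fun q : ℝ × ℝ × ℝ => u q.1 q.2.1 q.2.2) (Ici 0 ×ˢ univ))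
    (hv0 : ContinuousOn (fun q : ℝ × ℝ × ℝ => v q.1 q.2.1 q.2.2) (Ici 0 ×ˢ univ))
    {ℓ T C k : ℝ} (hℓ : 0 ≤ ℓ) (hk : 0 < k)
    (h0 : ∀ x y, u 0 (x + ℓ) y = u 0 x y ∧ v 0 (x + ℓ) y = v 0 x y)
    (hb : ∀ s ∈ Ioc 0 T, ∀ x y, |dX (u s) x y| + |dX (v s) x y| ≤ C * Real.exp (-k * |y|)) :
    ContinuousOn (fun s => ∫ q in Ioc 0 L ×ˢ univ,
      ((u s (q.1 + ℓ) q.2 - u s q.1 q.2) ^ 2 + (v s (q.1 + ℓ) q.2 - v s q.1 q.2) ^ 2))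
      (Icc 0 T) := by
  have he1 : ∀ y : ℝ, Real.exp (-k * |y|) ≤ 1 := fun y =>
    Real.exp_le_one_iff.2 (by nlinarith [abs_nonneg y, hk])
  have hux : ∀ s ∈ Ioc 0 T, ∀ x y, |dX (u s) x y| ≤ |C| * Real.exp (-k * |y|) := fun s hs x y => by
    nlinarith [hb s hs x y, abs_nonneg (dX (v s) x y), le_abs_self C, Real.exp_pos (-k * |y|)]
  have hvx : ∀ s ∈ Ioc 0 T, ∀ x y, |dX (v s) x y| ≤ |C| * Real.exp (-k * |y|) := fun s hs x y => by
    nlinarith [hb s hs x y, abs_nonneg (dX (u s) x y), le_abs_self C, Real.exp_pos (-k * |y|)]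
  have hda : ∀ s ∈ Icc 0 T, ∀ x y,
      |u s (x + ℓ) y - u s x y| ≤ |C| * ℓ * Real.exp (-k * |y|) := by
    intro s hs x y
    rcases hs.1.eq_or_lt with h00 | hs0
    · rw [← h00, (h0 x y).1, sub_self, abs_zero]; positivity
    · exact abs_shiftSub_le (h.contDiff_u hs0) two_ne_zero hℓ (hux s ⟨hs0, hs.2⟩) x y
  have hdb : ∀ s ∈ Icc 0 T, ∀ x y,
      |v s (x + ℓ) y - v s x y| ≤ |C| * ℓ * Real.exp (-k * |y|) := by
    intro s hs x y
    rcases hs.1.eq_or_lt with h00 | hs0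
    · rw [← h00, (h0 x y).2, sub_self, abs_zero]; positivity
    · exact abs_shiftSub_le (h.contDiff_v hs0) two_ne_zero hℓ (hvx s ⟨hs0, hs.2⟩) x y
  -- the dominating function
  set bound : ℝ × ℝ → ℝ := fun q => 2 * (|C| * ℓ) ^ 2 * Real.exp (-k * |q.2|) with hbound_def
  have hbc : Continuous bound :=
    continuous_const.mul (Real.continuous_exp.comp (continuous_const.mul
      (continuous_abs.comp continuous_snd)))
  have hbound : IntegrableOn bound (Ioc 0 L ×ˢ univ) :=
    integrableOn_strip_of_abs_le_exp hbc (C := 2 * (|C| * ℓ) ^ 2) (by positivity) hk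
      fun x _ y => by simp only [hbound_def]; rw [abs_of_nonneg (by positivity)]
  have hsq : ∀ {z M e : ℝ}, |z| ≤ M * e → 0 ≤ e → e ≤ 1 → z ^ 2 ≤ M ^ 2 * e := by
    intro z M e hz he0 he1
    have hM : 0 ≤ M * e := (abs_nonneg _).trans hz
    calc z ^ 2 = |z| ^ 2 := (sq_abs z).symm
      _ ≤ (M * e) ^ 2 := pow_le_pow_left₀ (abs_nonneg _) hz 2
      _ = M ^ 2 * e * e := by ring
      _ ≤ M ^ 2 * e * 1 := by gcongr
      _ = M ^ 2 * e := mul_one _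
  have hFle : ∀ s ∈ Icc 0 T, ∀ q : ℝ × ℝ,
      ‖(u s (q.1 + ℓ) q.2 - u s q.1 q.2) ^ 2 + (v s (q.1 + ℓ) q.2 - v s q.1 q.2) ^ 2‖ ≤
        bound q := by
    intro s hs q
    rw [Real.norm_of_nonneg (by positivity), hbound_def]
    have h1 := hsq (hda s hs q.1 q.2) (Real.exp_pos _).le (he1 q.2)
    have h2 := hsq (hdb s hs q.1 q.2) (Real.exp_pos _).le (he1 q.2)
    simp only
    linarith
  -- continuity in `q` and in `s`
  have hcq : ∀ s ∈ Icc 0 T, Continuous (fun q : ℝ × ℝ =>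
      (u s (q.1 + ℓ) q.2 - u s q.1 q.2) ^ 2 + (v s (q.1 + ℓ) q.2 - v s q.1 q.2) ^ 2) := by
    intro s hs
    have hsh : Continuous (fun q : ℝ × ℝ => (q.1 + ℓ, q.2)) :=
      (continuous_fst.add continuous_const).prodMk continuous_snd
    have cu := continuous_slice_of_continuousOn_Ici hu0 hs.1
    have cv := continuous_slice_of_continuousOn_Ici hv0 hs.1
    exact (((cu.comp hsh).sub cu).pow 2).add (((cv.comp hsh).sub cv).pow 2)
  have hcs : ∀ q : ℝ × ℝ, ContinuousOn (fun s =>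
      (u s (q.1 + ℓ) q.2 - u s q.1 q.2) ^ 2 + (v s (q.1 + ℓ) q.2 - v s q.1 q.2) ^ 2) (Icc 0 T) := by
    intro q
    have hsub : Icc 0 T ⊆ Ici 0 := Icc_subset_Ici_self
    have h1 := (continuousOn_time_of_continuousOn_Ici hu0 (q.1 + ℓ) q.2).mono hsub
    have h2 := (continuousOn_time_of_continuousOn_Ici hu0 q.1 q.2).mono hsub
    have h3 := (continuousOn_time_of_continuousOn_Ici hv0 (q.1 + ℓ) q.2).mono hsub
    have h4 := (continuousOn_time_of_continuousOn_Ici hv0 q.1 q.2).mono hsub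
    exact ((h1.sub h2).pow 2).add ((h3.sub h4).pow 2)
  exact continuousOn_of_dominated (fun s hs => (hcq s hs).aestronglyMeasurable)
    (fun s hs => Eventually.of_forall (hFle s hs)) hbound (Eventually.of_forall hcs)

/-! ### The strip energy is differentiable for `t > 0`, with `E' ≤ 2(2C + γ)E` -/

/-- **Differentiability of the shift energy and the differential inequality.** For a solution on
`(0, ∞)` (`L > 0`, `ν, γ ≥ 0`, shift `ℓ ≥ 0`) with the energy-class bounds on `(0, T]`
(constants `C, k`) and on `[δ, T]` (constant `C'`), at every `s ∈ (δ, T)` the strip energy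
`E(σ) = ∫∫_{(0,L]×ℝ} (|u(σ,x+ℓ,y) − u(σ,x,y)|² + |v(σ,x+ℓ,y) − v(σ,x,y)|²)` has a derivative
`E'(s) ≤ 2(2C + γ)E(s)`: differentiation under the integral sign
(`hasDerivAt_integral_of_dominated_loc_of_deriv_le`, domination `8CℓC'e^{−k|y|}`) and the basic
energy inequality on the strip for the shift difference (Majda–Bertozzi 2002, (3.5)).
[folklore] -/
theorem IsStretchedLayerNSSolutionOn.hasDerivAt_shiftEnergy
    (h : IsStretchedLayerNSSolutionOn (Ioi 0) ν γ ΔU L u v p) (hL : 0 < L) (hν : 0 ≤ ν)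
    (hγ : 0 ≤ γ) {ℓ T δ s C C' k : ℝ} (hℓ : 0 ≤ ℓ) (hk : 0 < k) (hδ : 0 < δ) (hs : s ∈ Ioo δ T)
    (hb : ∀ σ ∈ Ioc 0 T, ∀ x y,
      |u σ x y| + |v σ x y| + |dY (u σ) x y| + |dY (v σ) x y| ≤ C ∧
      |dX (u σ) x y| + |dX (v σ) x y| ≤ C * Real.exp (-k * |y|))
    (hb' : ∀ σ ∈ Icc δ T, ∀ x y, |deriv (fun r => u r x y) σ| + |deriv (fun r => v r x y) σ| +
      |dX (dX (u σ)) x y| + |dY (dY (u σ)) x y| + |dX (dX (v σ)) x y| + |dY (dY (v σ)) x y| ≤ C') :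
    ∃ φ : ℝ, HasDerivAt (fun σ => ∫ q in Ioc 0 L ×ˢ univ,
        ((u σ (q.1 + ℓ) q.2 - u σ q.1 q.2) ^ 2 + (v σ (q.1 + ℓ) q.2 - v σ q.1 q.2) ^ 2)) φ s ∧
      φ ≤ 2 * (2 * C + γ) * ∫ q in Ioc 0 L ×ˢ univ,
        ((u s (q.1 + ℓ) q.2 - u s q.1 q.2) ^ 2 + (v s (q.1 + ℓ) q.2 - v s q.1 q.2) ^ 2) := by
  have hs0 : 0 < s := hδ.trans hs.1
  set N : Set ℝ := Ioo δ T with hN_def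
  have hN : N ∈ 𝓝 s := Ioo_mem_nhds hs.1 hs.2
  have hN0 : ∀ σ ∈ N, 0 < σ := fun σ hσ => hδ.trans hσ.1
  have hNT : ∀ σ ∈ N, σ ∈ Ioc 0 T := fun σ hσ => ⟨hN0 σ hσ, hσ.2.le⟩
  have hNδ : ∀ σ ∈ N, σ ∈ Icc δ T := fun σ hσ => ⟨hσ.1.le, hσ.2.le⟩
  have hC0 : 0 ≤ C := le_trans (by positivity) (hb s (hNT s hs) 0 0).1
  have he1 : ∀ y : ℝ, Real.exp (-k * |y|) ≤ 1 := fun y =>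
    Real.exp_le_one_iff.2 (by nlinarith [abs_nonneg y, hk])
  -- bounds on the neighbourhood `N`
  have hux : ∀ σ ∈ N, ∀ x y, |dX (u σ) x y| ≤ C * Real.exp (-k * |y|) := fun σ hσ x y => by
    linarith [(hb σ (hNT σ hσ) x y).2, abs_nonneg (dX (v σ) x y)]
  have hvx : ∀ σ ∈ N, ∀ x y, |dX (v σ) x y| ≤ C * Real.exp (-k * |y|) := fun σ hσ x y => by
    linarith [(hb σ (hNT σ hσ) x y).2, abs_nonneg (dX (u σ) x y)]
  have hda : ∀ σ ∈ N, ∀ x y, |u σ (x + ℓ) y - u σ x y| ≤ C * ℓ * Real.exp (-k * |y|) :=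
    fun σ hσ x y => abs_shiftSub_le (h.contDiff_u (hN0 σ hσ)) two_ne_zero hℓ (hux σ hσ) x y
  have hdb : ∀ σ ∈ N, ∀ x y, |v σ (x + ℓ) y - v σ x y| ≤ C * ℓ * Real.exp (-k * |y|) :=
    fun σ hσ x y => abs_shiftSub_le (h.contDiff_v (hN0 σ hσ)) two_ne_zero hℓ (hvx σ hσ) x y
  have hut : ∀ σ ∈ N, ∀ x y, |deriv (fun r => u r x y) σ| ≤ C' := fun σ hσ x y => by
    linarith [hb' σ (hNδ σ hσ) x y, abs_nonneg (deriv (fun r => v r x y) σ),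
      abs_nonneg (dX (dX (u σ)) x y), abs_nonneg (dY (dY (u σ)) x y),
      abs_nonneg (dX (dX (v σ)) x y), abs_nonneg (dY (dY (v σ)) x y)]
  have hvt : ∀ σ ∈ N, ∀ x y, |deriv (fun r => v r x y) σ| ≤ C' := fun σ hσ x y => by
    linarith [hb' σ (hNδ σ hσ) x y, abs_nonneg (deriv (fun r => u r x y) σ),
      abs_nonneg (dX (dX (u σ)) x y), abs_nonneg (dY (dY (u σ)) x y),
      abs_nonneg (dX (dX (v σ)) x y), abs_nonneg (dY (dY (v σ)) x y)]
  have hC'0 : 0 ≤ C' := (abs_nonneg _).trans (hut s hs 0 0)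
  have hda' : ∀ σ ∈ N, ∀ x y,
      |deriv (fun r => u r (x + ℓ) y) σ - deriv (fun r => u r x y) σ| ≤ 2 * C' := fun σ hσ x y =>
    (abs_sub _ _).trans (by linarith [hut σ hσ (x + ℓ) y, hut σ hσ x y])
  have hdb' : ∀ σ ∈ N, ∀ x y,
      |deriv (fun r => v r (x + ℓ) y) σ - deriv (fun r => v r x y) σ| ≤ 2 * C' := fun σ hσ x y =>
    (abs_sub _ _).trans (by linarith [hvt σ hσ (x + ℓ) y, hvt σ hσ x y])
  -- the dominating functions
  have hec : Continuous (fun q : ℝ × ℝ => Real.exp (-k * |q.2|)) :=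
    Real.continuous_exp.comp (continuous_const.mul (continuous_abs.comp continuous_snd))
  set bound : ℝ × ℝ → ℝ := fun q => (8 * C * ℓ * C') * Real.exp (-k * |q.2|) with hbound_def
  have hbound : IntegrableOn bound (Ioc 0 L ×ˢ univ) :=
    integrableOn_strip_of_abs_le_exp (continuous_const.mul hec) (C := 8 * C * ℓ * C')
      (by positivity) hk
      fun x _ y => by simp only [hbound_def]; rw [abs_of_nonneg (by positivity)]
  have hF'le : ∀ σ ∈ N, ∀ q : ℝ × ℝ,
      ‖2 * ((u σ (q.1 + ℓ) q.2 - u σ q.1 q.2) *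
          (deriv (fun r => u r (q.1 + ℓ) q.2) σ - deriv (fun r => u r q.1 q.2) σ) +
        (v σ (q.1 + ℓ) q.2 - v σ q.1 q.2) *
          (deriv (fun r => v r (q.1 + ℓ) q.2) σ - deriv (fun r => v r q.1 q.2) σ))‖ ≤ bound q := by
    intro σ hσ q
    rw [Real.norm_eq_abs, abs_mul, abs_two, hbound_def]
    have h1 := abs_mul_le_mul_of_abs_le (hda σ hσ q.1 q.2) (hda' σ hσ q.1 q.2)
    have h2 := abs_mul_le_mul_of_abs_le (hdb σ hσ q.1 q.2) (hdb' σ hσ q.1 q.2)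
    have h3 := abs_add_le ((u σ (q.1 + ℓ) q.2 - u σ q.1 q.2) *
        (deriv (fun r => u r (q.1 + ℓ) q.2) σ - deriv (fun r => u r q.1 q.2) σ))
      ((v σ (q.1 + ℓ) q.2 - v σ q.1 q.2) *
        (deriv (fun r => v r (q.1 + ℓ) q.2) σ - deriv (fun r => v r q.1 q.2) σ))
    simp only
    nlinarith [Real.exp_pos (-k * |q.2|)]
  have hsq : ∀ {z M e : ℝ}, |z| ≤ M * e → 0 ≤ e → e ≤ 1 → z ^ 2 ≤ M ^ 2 * e := by
    intro z M e hz he0 he1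
    have hM : 0 ≤ M * e := (abs_nonneg _).trans hz
    calc z ^ 2 = |z| ^ 2 := (sq_abs z).symm
      _ ≤ (M * e) ^ 2 := pow_le_pow_left₀ (abs_nonneg _) hz 2
      _ = M ^ 2 * e * e := by ring
      _ ≤ M ^ 2 * e * 1 := by gcongr
      _ = M ^ 2 * e := mul_one _
  have hFint : IntegrableOn (fun q : ℝ × ℝ =>
      (u s (q.1 + ℓ) q.2 - u s q.1 q.2) ^ 2 + (v s (q.1 + ℓ) q.2 - v s q.1 q.2) ^ 2)
      (Ioc 0 L ×ˢ univ) :=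
    integrableOn_strip_of_abs_le_exp
      ((((contDiff_shiftSub (h.contDiff_u hs0) ℓ).continuous).pow 2).add
        (((contDiff_shiftSub (h.contDiff_v hs0) ℓ).continuous).pow 2))
      (by positivity : 0 ≤ 2 * (C * ℓ) ^ 2) hk fun x _ y => by
        rw [abs_of_nonneg (by positivity)]
        have h1 := hsq (hda s hs x y) (Real.exp_pos _).le (he1 y)
        have h2 := hsq (hdb s hs x y) (Real.exp_pos _).le (he1 y)
        linarith
  -- measurability
  have hsh : Continuous (fun q : ℝ × ℝ => (q.1 + ℓ, q.2)) :=
    (continuous_fst.add continuous_const).prodMk continuous_snd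
  have hFmeas : ∀ᶠ σ in 𝓝 s, AEStronglyMeasurable (fun q : ℝ × ℝ =>
      (u σ (q.1 + ℓ) q.2 - u σ q.1 q.2) ^ 2 + (v σ (q.1 + ℓ) q.2 - v σ q.1 q.2) ^ 2)
      (volume.restrict (Ioc 0 L ×ˢ univ)) := by
    filter_upwards [hN] with σ hσ
    exact ((((contDiff_shiftSub (h.contDiff_u (hN0 σ hσ)) ℓ).continuous).pow 2).add
      (((contDiff_shiftSub (h.contDiff_v (hN0 σ hσ)) ℓ).continuous).pow 2)).aestronglyMeasurable
  have cut := continuous_deriv_time isOpen_Ioi h.contDiffOn_u hs0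
  have cvt := continuous_deriv_time isOpen_Ioi h.contDiffOn_v hs0
  have hF'meas : AEStronglyMeasurable (fun q : ℝ × ℝ =>
      2 * ((u s (q.1 + ℓ) q.2 - u s q.1 q.2) *
          (deriv (fun r => u r (q.1 + ℓ) q.2) s - deriv (fun r => u r q.1 q.2) s) +
        (v s (q.1 + ℓ) q.2 - v s q.1 q.2) *
          (deriv (fun r => v r (q.1 + ℓ) q.2) s - deriv (fun r => v r q.1 q.2) s)))
      (volume.restrict (Ioc 0 L ×ˢ univ)) :=
    (continuous_const.mul
      (((contDiff_shiftSub (h.contDiff_u hs0) ℓ).continuous.mul ((cut.comp hsh).sub cut)).add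
      ((contDiff_shiftSub (h.contDiff_v hs0) ℓ).continuous.mul
        ((cvt.comp hsh).sub cvt)))).aestronglyMeasurable
  -- differentiability in time, pointwise in space
  have hdiff : ∀ q : ℝ × ℝ, ∀ σ ∈ N, HasDerivAt (fun σ =>
      (u σ (q.1 + ℓ) q.2 - u σ q.1 q.2) ^ 2 + (v σ (q.1 + ℓ) q.2 - v σ q.1 q.2) ^ 2)
      (2 * ((u σ (q.1 + ℓ) q.2 - u σ q.1 q.2) *
          (deriv (fun r => u r (q.1 + ℓ) q.2) σ - deriv (fun r => u r q.1 q.2) σ) +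
        (v σ (q.1 + ℓ) q.2 - v σ q.1 q.2) *
          (deriv (fun r => v r (q.1 + ℓ) q.2) σ - deriv (fun r => v r q.1 q.2) σ))) σ := by
    intro q σ hσ
    have h1 := hasDerivAt_time_of_contDiffOn_Ioi h.contDiffOn_u (hN0 σ hσ) (q.1 + ℓ) q.2
    have h2 := hasDerivAt_time_of_contDiffOn_Ioi h.contDiffOn_u (hN0 σ hσ) q.1 q.2
    have h3 := hasDerivAt_time_of_contDiffOn_Ioi h.contDiffOn_v (hN0 σ hσ) (q.1 + ℓ) q.2
    have h4 := hasDerivAt_time_of_contDiffOn_Ioi h.contDiffOn_v (hN0 σ hσ) q.1 q.2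
    refine (((h1.sub h2).pow 2).add ((h3.sub h4).pow 2)).congr_deriv ?_
    norm_num
    ring
  have key := hasDerivAt_integral_of_dominated_loc_of_deriv_le
    (μ := volume.restrict (Ioc 0 L ×ˢ univ)) (x₀ := s) (bound := bound) hN hFmeas hFint hF'meas
    (Eventually.of_forall fun q σ hσ => hF'le σ hσ q) hbound (Eventually.of_forall hdiff)
  refine ⟨_, key.2, ?_⟩
  -- the basic energy inequality for the shift difference at time `s`
  have hb1 : ∀ x y, |u s x y| + |v s x y| + |dY (u s) x y| + |dY (v s) x y| ≤ C :=
    fun x y => (hb s (hNT s hs) x y).1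
  have hb2 : ∀ x y, |dX (u s) x y| + |dX (v s) x y| ≤ C * Real.exp (-k * |y|) :=
    fun x y => (hb s (hNT s hs) x y).2
  have hSE := (h.stripEnergyHypotheses_shift hL hℓ hs0 hk hb1 hb2 (hb' s (hNδ s hs))
    ).integral_mul_add_mul_le hL.le hγ hν (strain_bounds_of_bounds hk hb1 hb2)
  rw [MeasureTheory.integral_const_mul]
  have hE0 : 0 ≤ ∫ q in Ioc 0 L ×ˢ univ,
      ((u s (q.1 + ℓ) q.2 - u s q.1 q.2) ^ 2 + (v s (q.1 + ℓ) q.2 - v s q.1 q.2) ^ 2) :=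
    setIntegral_nonneg (measurableSet_Ioc.prod MeasurableSet.univ) fun q _ => by positivity
  nlinarith [hSE]

/-! ### Period rigidity in the energy class -/

/-- **Period rigidity in the energy class.** A classical solution `(u, v, p)` of the stretched
two-dimensional Navier–Stokes layer system on the time set `(0, ∞)` with `x`-period `nℓ`
(`n ≥ 1`, `ℓ > 0`, viscosity `ν ≥ 0`, strain `γ ≥ 0`), whose velocity is continuous on
`[0, ∞) × ℝ²` with an `ℓ`-periodic datum `(u, v)(0, x + ℓ, y) = (u, v)(0, x, y)` and has
energy-class tails (`StretchedLayer.HasLayerEnergyTails u v`), has `ℓ`-periodic velocity for all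
`t ≥ 0`. Equivalently: uniqueness, in the energy class, of the solution relative to its own
`ℓ`-translate (which is again a solution with the same datum). Proof: the Majda–Bertozzi energy
method (2002, §3.1.1 Prop. 3.1 / Cor. 3.1, and the Remark after Prop. 3.4 — finite-energy
perturbations of a non-decaying background) for the shift difference
`W = (u, v)(t, ·+ℓ, ·) − (u, v)(t, ·, ·)` on the period strip `(0, nℓ] × ℝ`: transport `−γE`, strain
`≤ 4CE`, stretching `≤ 2γE`, pressure `0`, viscosity `≤ 0`, so `E' ≤ 2(2C + γ)E`, while
`E(0⁺) = E(0) = 0`; Grönwall gives `E ≡ 0`, continuity and periodicity give `W ≡ 0`. [folklore] -/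
theorem IsStretchedLayerNSSolutionOn.periodic_of_hasLayerEnergyTails
    {ν γ ΔU ℓ : ℝ} {n : ℕ} {u v p : ℝ → ℝ → ℝ → ℝ} (hν : 0 ≤ ν) (hγ : 0 ≤ γ) (hℓ : 0 < ℓ)
    (hn : 1 ≤ n) (h : IsStretchedLayerNSSolutionOn (Set.Ioi 0) ν γ ΔU (n * ℓ) u v p)
    (hu0 : ContinuousOn (fun q : ℝ × ℝ × ℝ => u q.1 q.2.1 q.2.2) (Set.Ici 0 ×ˢ Set.univ))
    (hv0 : ContinuousOn (fun q : ℝ × ℝ × ℝ => v q.1 q.2.1 q.2.2) (Set.Ici 0 ×ˢ Set.univ))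
    (h0 : ∀ x y : ℝ, u 0 (x + ℓ) y = u 0 x y ∧ v 0 (x + ℓ) y = v 0 x y)
    (hE : StretchedLayer.HasLayerEnergyTails u v) :
    ∀ t x y : ℝ, 0 ≤ t → u t (x + ℓ) y = u t x y ∧ v t (x + ℓ) y = v t x y := by
  intro t x₀ y₀ ht0
  rcases ht0.eq_or_lt with h00 | htpos
  · rw [← h00]; exact h0 x₀ y₀
  -- the period and the time horizon
  have hn0 : (0 : ℝ) < n := by exact_mod_cast hn
  have hL : (0 : ℝ) < n * ℓ := mul_pos hn0 hℓ
  set T : ℝ := t + 1 with hT_def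
  have hT : 0 < T := by rw [hT_def]; linarith
  have htT : t < T := by rw [hT_def]; linarith
  obtain ⟨⟨C, k, hk, hb⟩, hδ⟩ := hE T hT
  -- the strip energy of the shift difference
  set e : ℝ → ℝ := fun s => ∫ q in Ioc 0 (n * ℓ) ×ˢ univ,
    ((u s (q.1 + ℓ) q.2 - u s q.1 q.2) ^ 2 + (v s (q.1 + ℓ) q.2 - v s q.1 q.2) ^ 2) with he_def
  have hcont : ContinuousOn e (Icc 0 T) :=
    h.continuousOn_shiftEnergy hu0 hv0 hℓ.le hk h0 fun s hs x y => (hb s hs x y).2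
  have hderiv : ∀ s ∈ Ioo 0 T, ∃ φ, HasDerivAt e φ s ∧ φ ≤ 2 * (2 * C + γ) * e s := by
    intro s hs
    obtain ⟨C', hC'⟩ := hδ (s / 2) (half_pos hs.1)
    exact h.hasDerivAt_shiftEnergy hL hν hγ hℓ.le hk (half_pos hs.1)
      ⟨by linarith [hs.1], hs.2⟩ hb hC'
  have hnonneg : ∀ s ∈ Icc 0 T, 0 ≤ e s := fun s _ =>
    setIntegral_nonneg (measurableSet_Ioc.prod MeasurableSet.univ) fun q _ => by positivity
  have he0 : e 0 = 0 := by
    simp [he_def, fun x y => (h0 x y).1, fun x y => (h0 x y).2]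
  have het : e t = 0 :=
    eq_zero_of_hasDerivAt_le_mul hcont hderiv hnonneg he0 ⟨ht0, htT.le⟩
  -- hence the shift difference vanishes at time `t`: first on the open strip
  have hFc : Continuous (fun q : ℝ × ℝ =>
      (u t (q.1 + ℓ) q.2 - u t q.1 q.2) ^ 2 + (v t (q.1 + ℓ) q.2 - v t q.1 q.2) ^ 2) :=
    (((contDiff_shiftSub (h.contDiff_u htpos) ℓ).continuous).pow 2).add
      (((contDiff_shiftSub (h.contDiff_v htpos) ℓ).continuous).pow 2)
  have hC0 : 0 ≤ C := le_trans (by positivity) (hb t ⟨htpos, htT.le⟩ 0 0).1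
  have he1 : ∀ y : ℝ, Real.exp (-k * |y|) ≤ 1 := fun y =>
    Real.exp_le_one_iff.2 (by nlinarith [abs_nonneg y, hk])
  have hux : ∀ x y, |dX (u t) x y| ≤ C * Real.exp (-k * |y|) := fun x y => by
    linarith [(hb t ⟨htpos, htT.le⟩ x y).2, abs_nonneg (dX (v t) x y)]
  have hvx : ∀ x y, |dX (v t) x y| ≤ C * Real.exp (-k * |y|) := fun x y => by
    linarith [(hb t ⟨htpos, htT.le⟩ x y).2, abs_nonneg (dX (u t) x y)]
  have hFI : IntegrableOn (fun q : ℝ × ℝ =>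
      (u t (q.1 + ℓ) q.2 - u t q.1 q.2) ^ 2 + (v t (q.1 + ℓ) q.2 - v t q.1 q.2) ^ 2)
      (Ioc 0 (n * ℓ) ×ˢ univ) := by
    refine integrableOn_strip_of_abs_le_exp hFc (by positivity : 0 ≤ 2 * (C * ℓ) * (C * ℓ)) hk
      fun x _ y => ?_
    have h1 := abs_shiftSub_le (h.contDiff_u htpos) two_ne_zero hℓ.le hux x y
    have h2 := abs_shiftSub_le (h.contDiff_v htpos) two_ne_zero hℓ.le hvx x y
    have h1' : |u t (x + ℓ) y - u t x y| ≤ C * ℓ := h1.trans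
      (mul_le_of_le_one_right (by positivity) (he1 y))
    have h2' : |v t (x + ℓ) y - v t x y| ≤ C * ℓ := h2.trans
      (mul_le_of_le_one_right (by positivity) (he1 y))
    rw [abs_of_nonneg (by positivity), sq, sq]
    have h3 := abs_mul_le_mul_of_abs_le h1' h1
    have h4 := abs_mul_le_mul_of_abs_le h2' h2
    have h5 := le_abs_self ((u t (x + ℓ) y - u t x y) * (u t (x + ℓ) y - u t x y))
    have h6 := le_abs_self ((v t (x + ℓ) y - v t x y) * (v t (x + ℓ) y - v t x y))
    linarith
  have hstrip : ∀ x ∈ Ioo 0 (n * ℓ), ∀ y,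
      u t (x + ℓ) y - u t x y = 0 ∧ v t (x + ℓ) y - v t x y = 0 := by
    intro x hx y
    have hz := eq_zero_of_setIntegral_strip_eq_zero hFc (fun q => by positivity) hFI het hx y
    simp only at hz
    constructor <;> nlinarith [sq_nonneg (u t (x + ℓ) y - u t x y),
      sq_nonneg (v t (x + ℓ) y - v t x y)]
  -- then everywhere, by continuity and periodicity in `x`
  have hperu : ∀ x, u t (x + n * ℓ + ℓ) y₀ - u t (x + n * ℓ) y₀ = u t (x + ℓ) y₀ - u t x y₀ :=
    fun x => by rw [add_right_comm x (n * ℓ) ℓ, h.periodic_u t htpos, h.periodic_u t htpos]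
  have hperv : ∀ x, v t (x + n * ℓ + ℓ) y₀ - v t (x + n * ℓ) y₀ = v t (x + ℓ) y₀ - v t x y₀ :=
    fun x => by rw [add_right_comm x (n * ℓ) ℓ, h.periodic_v t htpos, h.periodic_v t htpos]
  have hcu : Continuous (fun x => u t (x + ℓ) y₀ - u t x y₀) :=
    continuous_slice_x (f := fun r s => u t (r + ℓ) s - u t r s)
      (contDiff_shiftSub (h.contDiff_u htpos) ℓ).continuous y₀
  have hcv : Continuous (fun x => v t (x + ℓ) y₀ - v t x y₀) :=
    continuous_slice_x (f := fun r s => v t (r + ℓ) s - v t r s)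
      (contDiff_shiftSub (h.contDiff_v htpos) ℓ).continuous y₀
  have hu' := eq_zero_of_eq_zero_on_Ioo_of_periodic hL hcu hperu (fun x hx => (hstrip x hx y₀).1) x₀
  have hv' := eq_zero_of_eq_zero_on_Ioo_of_periodic hL hcv hperv (fun x hx => (hstrip x hx y₀).2) x₀
  exact ⟨sub_eq_zero.1 hu', sub_eq_zero.1 hv'⟩

end Literature.Analysis.FluidPDE
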